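import Literature.NumberTheory.EllipticCurves.Newforms
import Literature.NumberTheory.EllipticCurves.CongruenceNumber
import Literature.AlgebraicGeometry.Motives.AbelianVariety
import Mathlib.GroupTheory.Index
import HarnessLib

/-!
# The Manin index of an optimal new quotient of `J₁(N)` (Conrad–Edixhoven–Stein 2003, §6.1.2)

B. Conrad, B. Edixhoven, W. A. Stein, *`J₁(p)` has connected fibers*, Doc. Math. 8 (2003)
331–408 [ConradEdixhovenStein2003], §6.1 (pp. 379–382 = held text
`paper:anon2003-j1-p-has-connected-fibers`, p0055–p0058). Definition item `defn-CESManinIndex`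
(route TeichmullerTwistDescent of the BSD summit, `stmt-BirchSwinnertonDyer-22638`).

The source, verbatim. Running hypothesis (p. 379): "Let `{f₁, …, f_n}` be a set of newforms in
`S₂(Γ₁(N))` that is `Gal(ℚ̄/ℚ)`-stable. Let `I` be the Hecke-algebra annihilator of the subspace
generated by `f₁, …, f_n`. […] we assume that `A = A_I = J₁(N)/I J₁(N)` for such an `I`. Note that
`A` is an optimal quotient in the sense that `I J₁(N) = ker(J₁(N) → A)` is an abelian subvariety of
`J₁(N)`." §6.1.2 (p. 380): "let `Ω_{A/ℤ}` denote the sheaf of relative 1-forms on the Néron model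
of `A` over `ℤ`, and let `I` be the annihilator of `A` in the Hecke algebra `T ⊂ End(J₁(N))`. For
a subring `R ⊂ ℂ`, let `S₂(Γ₁(N), R)` be the `R`-module of cusp forms whose Fourier expansion at
`∞` lies in `R[[q]]`. The natural surjective Hecke-equivariant morphism `J₁(N) → J₁(N)/I J₁(N) = A`
induces (by pullback) a Hecke-equivariant injection `Ψ_A : H⁰(A/ℤ, Ω_{A/ℤ}) ↪ S₂(Γ₁(N), ℚ)` whose
image lies in `S₂(Γ₁(N), ℚ)[I]`." **Definition 6.1.4 (Manin index).** "The Manin index of `A` is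
`c = [S₂(Γ₁(N), ℤ)[I] : Ψ_A(H⁰(A/ℤ, Ω_{A/ℤ}))] ∈ ℚ`." **Remark 6.1.5**: for an optimal
elliptic-curve quotient `X₀(N) → A` attached to a newform `f` "the usual Manin constant equals the
Manin index, since `S₂(Γ₁(N), ℤ)[I]` is generated as a `ℤ`-module by `f`." **Lemma 6.1.6.** "The
Manin index `c` of `A` is an integer." (Proof, p. 381: the `q`-expansion map
`Ψ : H⁰(A, Ω) → ℤ[[q]] dq/q` through the smooth `ℤ`-model `X_μ(N)` "is injective […] The image of
`Ψ` […] is a finite free `ℤ`-module, contained in the image of `S = S₂(Γ₁(N), ℤ)` […] Since `Ψ`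
respects the action of Hecke operators, the image of `Ψ` is contained in `S[I]`, so the lattice
index `c` is an integer.") **Conjecture 6.1.7.** "If `A = A_f` is a quotient of `J₁(N)` attached
to a single Galois-conjugacy class of newforms, then `c = 1`." **Remark 6.1.8**: the conjecture is
made only for a single Galois orbit, "since the more general conjecture is false" (Joyce: optimal
quotients of `J₁(p)`, `p = 431, 503, 2089`, with Manin index divisible by `2`).

## What this file declares (definitions with bodies; NO named fact, nothing asserted)

None of `X₁(N)`, `J₁(N)`, Néron models or the Albanese map `J₁(N) → A` exists in the tree or in
Mathlib (cf. the module docstrings of `NewformAbelianVariety.lean` and `ModularCurve.lean`), so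
`A_I` and `Ψ_A(H⁰(A_ℤ, Ω))` cannot be CONSTRUCTED at present. Following the interface idiom of
`NewformAbelianVariety g` (data `A : AbelianVariety ℚ` + exactly the printed properties) and of
`ModularParametrizationData W N` (the Manin constant of an elliptic curve as lattice data), the
file provides:

* §1 `integralCuspForms1 N k = S_k(Γ₁(N); ℤ)` — cusp forms on `Γ₁(N)` all of whose Fourier
  coefficients at `∞` (`cuspCoeff f n`, period-`1` expansion) are integers, as a `ℤ`-submodule
  (the `Γ₁` sibling of the tree's `integralCuspForms0`; CES's `S₂(Γ₁(N), ℤ)`);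
* §2 `heckeDiamondAlgebra1 N k = ℂ[T_p, ⟨d⟩ : p prime, d ∈ (ℤ/N)ˣ] ⊆ End S_k(Γ₁(N))` (the tree's
  `heckeAlgebra` deliberately omits the diamond operators; CES's `T` contains all `T_n` and `⟨n⟩`,
  and `ℤ[T_n, ⟨n⟩] = ℤ[T_p, ⟨d⟩]` by the prime-power recursion), the **annihilated subspace**
  `heckeAnnihilatedSubspace1 F = S_k(Γ₁(N))[I_F]`, `I_F = {T ∈ 𝕋 : T f = 0 ∀ f ∈ F}` (joint kernel
  of the annihilator of `F`), and `integralAnnihilatedForms1 F = S_k(Γ₁(N); ℤ)[I_F]` (their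
  intersection, a `ℤ`-submodule) — the left-hand lattice of Def. 6.1.4. (The annihilator is taken
  in the `ℂ`-algebra; since `𝕋_ℤ ⊗ ℂ = 𝕋_ℂ` the annihilated subspace is the printed one.)
* §3 Galois stability of a finite set of forms, `IsGaloisStableForms F` ("`Gal(ℚ̄/ℚ)`-stable":
  for every field automorphism `σ` of `ℂ` and `f ∈ F` some `f' ∈ F` has `aₙ(f') = σ(aₙ(f))` for all
  `n` — Diamond–Shurman Thm. 6.5.4 phrases the Galois action on newforms through automorphisms of
  `ℂ`), and `IsSingleGaloisOrbitForms F` (moreover any two members are conjugate) — the hypothesis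
  of Conj. 6.1.7.
* §4 the **interface** `CESOptimalQuotient N`: a `Gal`-stable finite set `newforms` of newforms
  (`IsNewform1`), an abelian variety `A : AbelianVariety ℚ` ("`A = A_I = J₁(N)/I J₁(N)`") with
  `dim A = n` (Diamond–Shurman Def. 6.6.3 / Prop. 6.6.4, summed over the orbits), and the lattice
  `neronForms` ("`Ψ_A(H⁰(A/ℤ, Ω_{A/ℤ}))`", the `q`-expansions of the Néron differentials) with
  exactly its printed properties: contained in `S₂(Γ₁(N); ℤ)[I]` (proof of Lemma 6.1.6), free of
  rank `n = dim A` (`Ψ_A` injective on the rank-`dim A` lattice `H⁰(A_ℤ, Ω)`), stable under the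
  `T_p` and `⟨d⟩` (`Ψ_A` Hecke-equivariant); and the **Manin index**
  `CESOptimalQuotient.maninIndex D := [S₂(Γ₁(N); ℤ)[I] : neronForms]` (Def. 6.1.4), a natural
  number (`AddSubgroup.relIndex`; by Lemma 6.1.6 the printed `c ∈ ℚ` is this integer index), with
  unfolding lemmas. No map to or from `J₁(N)` is part of the structure (the tree has no `J₁(N)`).

## Caveats (read before quantifying over `CESOptimalQuotient N`)

* The fields do NOT determine `neronForms` (nor `A` beyond its dimension): the geometric input
  that pins `Ψ_A(H⁰(A_ℤ, Ω))` down — Néron models and the map `J₁(N) → A` — is not formalisable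
  today. Hence, exactly as for `NewformAbelianVariety` ("statements sensitive to the isomorphism
  class … must carry the extra data they use as hypotheses"), results ABOUT the Manin index of the
  true `A_I` (Conj. 6.1.7, its `p`-parts, Remark 6.1.5) are to be stated over a GIVEN datum `D`
  supplied by a crux / as conjecture items under `Summits/`, never as closed Literature facts
  `∀ D : CESOptimalQuotient N, …` (which would speak about arbitrary lattices).
* Conjecture 6.1.7 is an open problem and is NOT vendored here (conjectures are not Literature);
  its hypothesis is `IsSingleGaloisOrbitForms ↑D.newforms`, its conclusion `D.maninIndex = 1`.
* Positivity of the index (`c ≠ 0`, i.e. `neronForms` of finite index in `S₂(Γ₁(N); ℤ)[I]`) needs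
  `dim_ℂ S₂(Γ₁(N))[I] = n` (multiplicity one for new subspaces), which the tree does not have for
  `Γ₁(N)`; it is not recorded as a field.

## References

* [ConradEdixhovenStein2003] B. Conrad, B. Edixhoven, W. A. Stein, *`J₁(p)` has connected
  fibers*, Doc. Math. 8 (2003) 331–408: §6.1 (running hypothesis, p. 379), §6.1.2, Def. 6.1.4,
  Rem. 6.1.5, Lemma 6.1.6 (with proof), Conj. 6.1.7, Rem. 6.1.8–6.1.9 (pp. 380–382).
* [DiamondShurman2005] F. Diamond, J. Shurman, *A First Course in Modular Forms*, GTM 228: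
  §5.2–5.3 (`T_n`, `⟨n⟩`, Prop. 5.2.2, Thm. 5.3.? recursion `T_{p^r}`), Thm. 6.5.4 (Galois
  conjugates of newforms), Def. 6.6.3 and Prop. 6.6.4 (`A_f = J₁(M_f)/I_f J₁(M_f)`, `dim A_f = [K_f : ℚ]`).
* [AgasheRibetStein2006] A. Agashe, K. Ribet, W. A. Stein, *The Manin constant*, PAMQ 2 (2006)
  (the Manin constant of quotients of `J₀(N)` of dimension `> 1`; elliptic case in the tree:
  `ModularParametrizationData.maninConstant`, `ModularCurve.lean`).
-/

noncomputable section

open scoped MatrixGroups ModularForm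

open CongruenceSubgroup UpperHalfPlane
open Literature.AlgebraicGeometry.Motives (AbelianVariety)

namespace Literature.NumberTheory.EllipticCurves.ModularForms

/-! ### §1 `S_k(Γ₁(N); ℤ)` -/

section Integral

variable (N : ℕ) (k : ℤ)

/-- **`S_k(Γ₁(N); ℤ)`** — CES's `S₂(Γ₁(N), ℤ)` in weight `k`: "the `R`-module of cusp forms whose
Fourier expansion at `∞` lies in `R[[q]]`" for `R = ℤ`, i.e. the cusp forms `f = ∑ aₙ qⁿ` on
`Γ₁(N)` (`aₙ = cuspCoeff f n`, period-`1` expansion, `(1 1; 0 1) ∈ Γ₁(N)`) with `aₙ ∈ ℤ` for all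
`n`, as a `ℤ`-submodule of `S_k(Γ₁(N))` (the `Γ₁` sibling of `integralCuspForms0`).
[cite: ConradEdixhovenStein2003, §6.1.2 (p. 380)] -/
def integralCuspForms1 : Submodule ℤ (CuspForm (Gamma1 N) k) :=
  AddSubgroup.toIntSubmodule
    { carrier := {f | ∀ n, ∃ z : ℤ, (z : ℂ) = cuspCoeff f n}
      add_mem' := fun {f g} hf hg n ↦ by
        obtain ⟨a, ha⟩ := hf n
        obtain ⟨b, hb⟩ := hg n
        exact ⟨a + b, by
          rw [cuspCoeff_add_form (HeckeTGamma1.one_mem_strictPeriods_Gamma1 N) f g n, ← ha, ← hb,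
            Int.cast_add]⟩
      zero_mem' := fun n ↦ ⟨0, by
        rw [Int.cast_zero, cuspCoeff, CuspForm.coe_zero, qExpansion_zero, map_zero]⟩
      neg_mem' := fun {f} hf n ↦ by
        obtain ⟨z, hz⟩ := hf n
        exact ⟨-z, by
          rw [cuspCoeff_neg_form (HeckeTGamma1.one_mem_strictPeriods_Gamma1 N) f n, ← hz,
            Int.cast_neg]⟩ }

variable {N k}

/-- Membership in `S_k(Γ₁(N); ℤ)`: all Fourier coefficients at `∞` are integers (unfolding lemma).
[cite: ConradEdixhovenStein2003, §6.1.2 (p. 380)] -/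
@[simp] theorem mem_integralCuspForms1 {f : CuspForm (Gamma1 N) k} :
    f ∈ integralCuspForms1 N k ↔ ∀ n, ∃ z : ℤ, (z : ℂ) = cuspCoeff f n :=
  Iff.rfl

end Integral

/-! ### §2 The Hecke algebra with diamond operators and the annihilated subspace `S[I]` -/

section Annihilator

variable (N : ℕ) [NeZero N] (k : ℤ)

/-- **The Hecke algebra `𝕋 = ℂ[T_p, ⟨d⟩]` of level `Γ₁(N)` and weight `k`**: the `ℂ`-subalgebra of
`End_ℂ(S_k(Γ₁(N)))` generated by the Hecke operators `T_p` (`heckeT (Gamma1 N) k p`, all primes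
`p`; `U_p` for `p ∣ N`) AND the diamond operators `⟨d⟩` (`diamondOp N k d`, `d ∈ (ℤ/Nℤ)ˣ`). CES's
`T ⊂ End(J₁(N))` is generated by all `T_n` and `⟨n⟩`; since `T_{mn} = T_m T_n` for coprime `m, n`
and `T_{p^{r+1}} = T_p T_{p^r} − p^{k−1}⟨p⟩ T_{p^{r−1}}` (Diamond–Shurman §5.3), the `T_p` and
`⟨d⟩` generate the same algebra. (The tree's `heckeAlgebra Γ k` omits the `⟨d⟩` by design.)
[cite: ConradEdixhovenStein2003, §6.1.2 (p. 380)] [cite: DiamondShurman2005, §5.2–5.3] -/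
def heckeDiamondAlgebra1 : Subalgebra ℂ (Module.End ℂ (CuspForm (Gamma1 N) k)) :=
  Algebra.adjoin ℂ
    ((Set.range fun p : Nat.Primes ↦
        haveI : NeZero (p : ℕ) := ⟨p.2.ne_zero⟩
        heckeT (Gamma1 N) k p) ∪
      Set.range fun d : (ZMod N)ˣ ↦ diamondOp N k (d : ZMod N))

variable {N k} in
/-- `T_p ∈ 𝕋` for `p` prime (by definition). [cite: ConradEdixhovenStein2003, §6.1.2 (p. 380)] -/
theorem heckeT_mem_heckeDiamondAlgebra1 (p : ℕ) [NeZero p] (hp : p.Prime) :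
    heckeT (Gamma1 N) k p ∈ heckeDiamondAlgebra1 N k := by
  refine Algebra.subset_adjoin (Or.inl ⟨⟨p, hp⟩, ?_⟩)
  rfl

variable {N k} in
/-- `⟨d⟩ ∈ 𝕋` for `d ∈ (ℤ/Nℤ)ˣ` (by definition). [cite: ConradEdixhovenStein2003, §6.1.2 (p. 380)] -/
theorem diamondOp_mem_heckeDiamondAlgebra1 (d : (ZMod N)ˣ) :
    diamondOp N k (d : ZMod N) ∈ heckeDiamondAlgebra1 N k :=
  Algebra.subset_adjoin (Or.inr ⟨d, rfl⟩)

/-- **The annihilator `I_F ⊆ 𝕋` of a set of forms `F`**: the Hecke operators (in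
`heckeDiamondAlgebra1`) killing every `f ∈ F` — CES: "`I` the Hecke-algebra annihilator of the
subspace generated by `f₁, …, f_n`" (killing the `fᵢ` is killing their span), as a set of
endomorphisms. [cite: ConradEdixhovenStein2003, §6.1 (p. 379)] -/
def heckeAnnihilator1 (F : Set (CuspForm (Gamma1 N) k)) : Set (Module.End ℂ (CuspForm (Gamma1 N) k)) :=
  {T | T ∈ heckeDiamondAlgebra1 N k ∧ ∀ f ∈ F, T f = 0}

/-- **`S_k(Γ₁(N))[I_F]`**, the subspace annihilated by the annihilator ideal `I_F` of `F`: the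
joint kernel `⋂_{T ∈ I_F} ker T` (CES: "`S₂(Γ₁(N), ℚ)[I]`", "`S[I]`").
[cite: ConradEdixhovenStein2003, §6.1.2 (p. 380)] -/
def heckeAnnihilatedSubspace1 (F : Set (CuspForm (Gamma1 N) k)) :
    Submodule ℂ (CuspForm (Gamma1 N) k) :=
  ⨅ T ∈ heckeAnnihilator1 N k F, LinearMap.ker T

/-- **`S_k(Γ₁(N); ℤ)[I_F]`** — the left-hand lattice of Def. 6.1.4: integral cusp forms annihilated
by `I_F`, i.e. `S_k(Γ₁(N))[I_F] ∩ S_k(Γ₁(N); ℤ)` as a `ℤ`-submodule.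
[cite: ConradEdixhovenStein2003, Def. 6.1.4 (p. 380)] -/
def integralAnnihilatedForms1 (F : Set (CuspForm (Gamma1 N) k)) :
    Submodule ℤ (CuspForm (Gamma1 N) k) :=
  (heckeAnnihilatedSubspace1 N k F).restrictScalars ℤ ⊓ integralCuspForms1 N k

variable {N k}

/-- Membership in `S_k(Γ₁(N))[I_F]`: `g` is killed by every Hecke operator killing `F` (unfolding
lemma). [cite: ConradEdixhovenStein2003, §6.1.2 (p. 380)] -/
theorem mem_heckeAnnihilatedSubspace1 {F : Set (CuspForm (Gamma1 N) k)}
    {g : CuspForm (Gamma1 N) k} :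
    g ∈ heckeAnnihilatedSubspace1 N k F ↔ ∀ T ∈ heckeAnnihilator1 N k F, T g = 0 := by
  simp [heckeAnnihilatedSubspace1, Submodule.mem_iInf, LinearMap.mem_ker]

/-- Every `f ∈ F` lies in `S_k(Γ₁(N))[I_F]` (the annihilator of `F` kills `F`).
[cite: ConradEdixhovenStein2003, §6.1.2 (p. 380)] -/
theorem mem_heckeAnnihilatedSubspace1_of_mem {F : Set (CuspForm (Gamma1 N) k)}
    {f : CuspForm (Gamma1 N) k} (hf : f ∈ F) : f ∈ heckeAnnihilatedSubspace1 N k F :=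
  mem_heckeAnnihilatedSubspace1.mpr fun _ hT ↦ hT.2 f hf

/-- Membership in `S_k(Γ₁(N); ℤ)[I_F]` (unfolding lemma).
[cite: ConradEdixhovenStein2003, Def. 6.1.4 (p. 380)] -/
theorem mem_integralAnnihilatedForms1 {F : Set (CuspForm (Gamma1 N) k)}
    {g : CuspForm (Gamma1 N) k} :
    g ∈ integralAnnihilatedForms1 N k F ↔
      g ∈ heckeAnnihilatedSubspace1 N k F ∧ ∀ n, ∃ z : ℤ, (z : ℂ) = cuspCoeff g n :=
  Iff.rfl

end Annihilator

/-! ### §3 Galois-stable sets of forms -/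

section Galois

variable {N : ℕ} {k : ℤ}

/-- **A `Gal(ℚ̄/ℚ)`-stable set of forms** (CES: "a set of newforms in `S₂(Γ₁(N))` that is
`Gal(ℚ̄/ℚ)`-stable"): for every field automorphism `σ` of `ℂ` and every `f ∈ F`, the conjugate
`q`-expansion `∑ σ(aₙ(f)) qⁿ` is that of some `f' ∈ F` (for a newform `f`, `f^σ := ∑ σ(aₙ) qⁿ` is a
newform, Diamond–Shurman Thm. 6.5.4, and the coefficients are algebraic, so stability under
`Aut(ℂ)` is stability under `Gal(ℚ̄/ℚ)`). [cite: ConradEdixhovenStein2003, §6.1 (p. 379)]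
[cite: DiamondShurman2005, Thm. 6.5.4] -/
def IsGaloisStableForms (F : Set (CuspForm (Gamma1 N) k)) : Prop :=
  ∀ σ : ℂ ≃+* ℂ, ∀ f ∈ F, ∃ f' ∈ F, ∀ n, cuspCoeff f' n = σ (cuspCoeff f n)

/-- **A single Galois-conjugacy class of forms** ("`A = A_f` … attached to a single
Galois-conjugacy class of newforms", the hypothesis under which CES state 6.1.7; Rem. 6.1.8 explains
why several orbits are excluded): `F` is `Gal`-stable and any two members have `Aut(ℂ)`-conjugate
`q`-expansions. For a datum `D : CESOptimalQuotient N` below, the hypothesis reads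
`IsSingleGaloisOrbitForms ↑D.newforms`. [cite: ConradEdixhovenStein2003, §6.1.2, 6.1.7–6.1.8 (pp. 381–382)] -/
def IsSingleGaloisOrbitForms (F : Set (CuspForm (Gamma1 N) k)) : Prop :=
  IsGaloisStableForms F ∧
    ∀ f ∈ F, ∀ f' ∈ F, ∃ σ : ℂ ≃+* ℂ, ∀ n, cuspCoeff f' n = σ (cuspCoeff f n)

/-- A single Galois orbit is in particular `Gal`-stable. [cite: ConradEdixhovenStein2003, §6.1 (p. 379)] -/
theorem IsSingleGaloisOrbitForms.isGaloisStableForms {F : Set (CuspForm (Gamma1 N) k)}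
    (h : IsSingleGaloisOrbitForms F) : IsGaloisStableForms F :=
  h.1

/-- A singleton is a single Galois orbit as soon as it is `Gal`-stable (e.g. a newform with
rational coefficients). [cite: ConradEdixhovenStein2003, Rem. 6.1.5 (p. 380)] -/
theorem isSingleGaloisOrbitForms_singleton {f : CuspForm (Gamma1 N) k}
    (h : IsGaloisStableForms ({f} : Set (CuspForm (Gamma1 N) k))) :
    IsSingleGaloisOrbitForms ({f} : Set (CuspForm (Gamma1 N) k)) := by
  refine ⟨h, fun g hg g' hg' ↦ ⟨RingEquiv.refl ℂ, fun n ↦ ?_⟩⟩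
  rw [Set.mem_singleton_iff] at hg hg'
  subst hg hg'
  rfl

end Galois

/-! ### §4 The interface `CESOptimalQuotient N` and the Manin index -/

section Interface

variable (N : ℕ) [NeZero N]

/-- **An optimal new quotient `A = A_I = J₁(N)/I J₁(N)` of `J₁(N)` together with its lattice of
Néron differentials** (Conrad–Edixhoven–Stein 2003, §6.1–6.1.2), as an INTERFACE (the tree has no
`J₁(N)`, no Néron models and no Albanese map, so the data cannot be constructed; cf.
`NewformAbelianVariety`): a finite `Gal(ℚ̄/ℚ)`-stable set `{f₁, …, f_n}` of newforms in
`S₂(Γ₁(N))`, an abelian variety `A/ℚ` of dimension `n` (the optimal quotient attached to the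
Hecke annihilator `I` of `span{fᵢ}`; `dim A_I = n`, Diamond–Shurman Def. 6.6.3 / Prop. 6.6.4 summed
over the Galois orbits), and the sublattice `Ψ_A(H⁰(A/ℤ, Ω_{A/ℤ})) ⊆ S₂(Γ₁(N), ℚ)[I]` of
`q`-expansions at `∞` of the global 1-forms on the Néron model, with its PRINTED properties:
contained in `S₂(Γ₁(N), ℤ)[I]` (proof of Lemma 6.1.6), a free `ℤ`-module of rank `n = dim A`
(`Ψ_A` is injective and `H⁰(A_ℤ, Ω)` is free of rank `dim A`), and stable under the Hecke and
diamond operators (`Ψ_A` is Hecke-equivariant). CAVEAT: the fields do not determine `neronForms`;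
see the module docstring before quantifying over this structure.
[cite: ConradEdixhovenStein2003, §6.1 (p. 379), §6.1.2 and proof of Lemma 6.1.6 (pp. 380–381)]
[cite: DiamondShurman2005, Def. 6.6.3, Prop. 6.6.4] -/
structure CESOptimalQuotient : Type 1 where
  /-- The `Gal(ℚ̄/ℚ)`-stable set of newforms `{f₁, …, f_n} ⊆ S₂(Γ₁(N))`. -/
  newforms : Finset (CuspForm (Gamma1 N) 2)
  /-- Each `fᵢ` is a newform on `Γ₁(N)` (`IsNewform1`). -/
  isNewform : ∀ f ∈ newforms, IsNewform1 f
  /-- `{f₁, …, f_n}` is `Gal(ℚ̄/ℚ)`-stable. -/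
  galoisStable : IsGaloisStableForms (↑newforms : Set (CuspForm (Gamma1 N) 2))
  /-- The optimal quotient `A = A_I = J₁(N)/I J₁(N)` over `ℚ`. -/
  A : AbelianVariety.{0} ℚ
  /-- `dim A_I = n` (Diamond–Shurman Prop. 6.6.4, summed over the Galois orbits in `{fᵢ}`). -/
  dim_eq : A.dim = newforms.card
  /-- `Ψ_A(H⁰(A/ℤ, Ω_{A/ℤ}))`: the `q`-expansions at `∞` of the Néron differentials of `A`,
  a `ℤ`-lattice of cusp forms (§6.1.2). -/
  neronForms : Submodule ℤ (CuspForm (Gamma1 N) 2)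
  /-- "the image of `Ψ` is contained in `S[I]`", `S = S₂(Γ₁(N), ℤ)` (proof of Lemma 6.1.6). -/
  neronForms_le : neronForms ≤ integralAnnihilatedForms1 N 2 (↑newforms : Set (CuspForm (Gamma1 N) 2))
  /-- `Ψ_A(H⁰(A_ℤ, Ω))` is a free `ℤ`-module of rank `dim A = n` ("a finite free `ℤ`-module";
  `Ψ_A` injective, §6.1.2). -/
  finrank_neronForms : Module.finrank ℤ neronForms = newforms.card
  /-- `Ψ_A` is Hecke-equivariant: the lattice is stable under every `T_p`, `p` prime (§6.1.2). -/
  heckeT_mem : ∀ (p : ℕ) (hp : p.Prime), ∀ g ∈ neronForms,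
    (haveI : NeZero p := ⟨hp.ne_zero⟩; heckeT (Gamma1 N) 2 p g) ∈ neronForms
  /-- `Ψ_A` is Hecke-equivariant: the lattice is stable under every diamond operator `⟨d⟩` (§6.1.2). -/
  diamondOp_mem : ∀ (d : (ZMod N)ˣ), ∀ g ∈ neronForms, diamondOp N 2 (d : ZMod N) g ∈ neronForms

namespace CESOptimalQuotient

variable {N} (D : CESOptimalQuotient N)

/-- The annihilated integral lattice `S₂(Γ₁(N), ℤ)[I]` of the datum (left-hand side of Def. 6.1.4).
[cite: ConradEdixhovenStein2003, Def. 6.1.4 (p. 380)] -/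
def integralForms : Submodule ℤ (CuspForm (Gamma1 N) 2) :=
  integralAnnihilatedForms1 N 2 (↑D.newforms : Set (CuspForm (Gamma1 N) 2))

/-- **The Manin index `c = [S₂(Γ₁(N), ℤ)[I] : Ψ_A(H⁰(A/ℤ, Ω_{A/ℤ}))]`** of the optimal quotient
(Def. 6.1.4), as the index of the subgroup `neronForms` in `S₂(Γ₁(N), ℤ)[I]` — a natural number:
by Lemma 6.1.6 (`Ψ_A(H⁰) ⊆ S₂(Γ₁(N), ℤ)[I]`, the field `neronForms_le`) the printed generalized
lattice index `c ∈ ℚ` IS this subgroup index (`AddSubgroup.relIndex`; value `0` would encode an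
infinite index). For an optimal elliptic-curve quotient of `X₀(N)` it is the usual Manin constant
(Rem. 6.1.5; tree: `ModularParametrizationData.maninConstant`).
[cite: ConradEdixhovenStein2003, Def. 6.1.4 and Lemma 6.1.6 (pp. 380–381)] -/
def maninIndex : ℕ :=
  D.neronForms.toAddSubgroup.relIndex D.integralForms.toAddSubgroup

/-- Unfolding the Manin index: the relative index of `Ψ_A(H⁰(A_ℤ, Ω))` in `S₂(Γ₁(N), ℤ)[I]`.
[cite: ConradEdixhovenStein2003, Def. 6.1.4 (p. 380)] -/
theorem maninIndex_def :
    D.maninIndex = D.neronForms.toAddSubgroup.relIndex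
      (integralAnnihilatedForms1 N 2 (↑D.newforms : Set (CuspForm (Gamma1 N) 2))).toAddSubgroup :=
  rfl

/-- Lemma 6.1.6 in the interface: `Ψ_A(H⁰(A_ℤ, Ω)) ⊆ S₂(Γ₁(N), ℤ)[I]`, so the Manin index is the
index of a SUBGROUP, `c = [S₂(Γ₁(N), ℤ)[I] : Ψ_A(H⁰)] = |S₂(Γ₁(N), ℤ)[I] / Ψ_A(H⁰)|`
(`AddSubgroup.relIndex` of a subgroup contained in the other is the index of `H.addSubgroupOf K`).
[cite: ConradEdixhovenStein2003, Lemma 6.1.6 (p. 381)] -/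
theorem maninIndex_eq_index :
    D.maninIndex = (D.neronForms.toAddSubgroup.addSubgroupOf D.integralForms.toAddSubgroup).index :=
  rfl

/-- The Néron forms have integral Fourier coefficients: `Ψ_A(H⁰(A_ℤ, Ω)) ⊆ S₂(Γ₁(N), ℤ)` ("contained
in the image of `S = S₂(Γ₁(N), ℤ)`"). [cite: ConradEdixhovenStein2003, proof of Lemma 6.1.6 (p. 381)] -/
theorem neronForms_le_integralCuspForms1 : D.neronForms ≤ integralCuspForms1 N 2 :=
  fun _ hg ↦ (D.neronForms_le hg).2

/-- The Néron forms are annihilated by `I`: `Ψ_A(H⁰(A_ℤ, Ω)) ⊆ S₂(Γ₁(N))[I]` ("the image of `Ψ` is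
contained in `S[I]`"). [cite: ConradEdixhovenStein2003, proof of Lemma 6.1.6 (p. 381)] -/
theorem neronForms_le_heckeAnnihilatedSubspace1 :
    D.neronForms ≤ (heckeAnnihilatedSubspace1 N 2
      (↑D.newforms : Set (CuspForm (Gamma1 N) 2))).restrictScalars ℤ :=
  fun _ hg ↦ (D.neronForms_le hg).1

/-- Each Fourier coefficient of a Néron form is an integer.
[cite: ConradEdixhovenStein2003, proof of Lemma 6.1.6 (p. 381)] -/
theorem exists_int_eq_cuspCoeff_of_mem_neronForms {g : CuspForm (Gamma1 N) 2}
    (hg : g ∈ D.neronForms) (n : ℕ) : ∃ z : ℤ, (z : ℂ) = cuspCoeff g n :=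
  (mem_integralCuspForms1.mp (D.neronForms_le_integralCuspForms1 hg)) n

/-- Every newform `fᵢ` of the datum lies in `S₂(Γ₁(N))[I]`.
[cite: ConradEdixhovenStein2003, §6.1.2 (p. 380)] -/
theorem mem_heckeAnnihilatedSubspace1_of_mem_newforms {f : CuspForm (Gamma1 N) 2}
    (hf : f ∈ D.newforms) :
    f ∈ heckeAnnihilatedSubspace1 N 2 (↑D.newforms : Set (CuspForm (Gamma1 N) 2)) :=
  mem_heckeAnnihilatedSubspace1_of_mem (Finset.mem_coe.mpr hf)

end CESOptimalQuotient

end Interface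

end Literature.NumberTheory.EllipticCurves.ModularForms
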